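import Literature.NumberTheory.Automorphic.TorusCharacterSplitRigidity   -- ★ `torusCharacter_eq_one_of_split` (ALL split places) and its toolkit (`twist_snd_apply`, `valued_gal_mul_inv_sub_one_le`, `smul_smul_place`, …)
import HarnessLib

/-!
# Rigidity of automorphic characters of the norm-one torus `T = U(1)_{K/F₀}` from ALL BUT FINITELY MANY split places
# (weak approximation for the rational one-dimensional torus; Cassels–Fröhlich Ch. II §6, Ch. VII §4 Prop. 4.1; Platonov–Rapinchuk §7.3 Prop. 7.8)

Topic `NumberTheory/Automorphic`; namespace `Literature.NumberTheory.Automorphic.UnitaryGroup`.  PROOF FILE: theorems only (no definition, no named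
fact, no instance, no notation, no `sorry`).  Companion of ★ `TorusCharacterSplitRigidity` (same setting: quadratic `K/F₀` with non-trivial automorphism
`c`, `h2 : [K : F₀] = 2`, `hc : c ≠ 1`, the adelic norm-one torus `TorusDict.torus c ≤ 𝕀_K`, automorphic characters `ψ` and their base change
`χ̃ = TorusDict.pullback ψ = ψ ∘ (z ↦ c • z / z)`).

THE THEOREM.  ★ `torusCharacter_eq_one_of_split` assumes the base change trivial on `K_wˣ` at EVERY `c`-moved finite place `w` (= every place over a
SPLIT place of `F₀`).  Here a FINITE EXCEPTIONAL SET `E` of places of `K` is allowed: **an automorphic character of `T(𝔸_{F₀})` whose base change is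
trivial on `K_wˣ` for every moved `w ∉ E` is trivial** (`torusCharacter_eq_one_of_split_of_not_mem`); hence two automorphic characters whose base changes
have the same local components at the moved places outside `E` are equal (`torusCharacter_eq_of_split_of_not_mem`).  The cofinite currency the
consumers need («labels agree at one place above every split `v ∉ S₁`», `S₁` finite — e.g. a discrete `P` ROUTED by `ξ` off `S₁` and lying in the ξ′-family).

PROOF = the ★ proof VERBATIM with ONE change: the `c`-stable finite set `E′ = E ∪ c • E` JOINS THE WEAK-APPROXIMATION SET.  In ★, for an idele `z` one
picks `a ∈ K^×` close to `z` at the places named by a neighbourhood of `1` and at `∞` (★ `denseRange_algebraMap_pi_prod`), sets `y = z a⁻¹`, and PEELS OFF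
the components of `y` at the finitely many offending moved places with the hypothesis; the twist `c • y₁ / y₁` of the rest is integral at the non-moved
places (norm one ⇒ unit) and close to `1` where required.  With exceptions, the moved places in `E′` cannot be peeled; instead `a` is ALSO taken close
to `z` at `E′` (to the order `e_w + e_{c w} + 1`), so that at `w ∈ E′` both `y_w` and `y_{c⁻¹ w}` are units next to `1`, and the twist component
`c_*(y_{c⁻¹ w}) · y_w⁻¹` is a unit within `q_w^{-e_w}` of `1` (`valued_gal_mul_inv_sub_one_le_of_moved`, the two-place twin of ★ `valued_gal_mul_inv_sub_one_le`).
Equivalently: `T(F₀) · ∏'_{v split, v ∉ S} T(F₀,v)` is still dense in `T(𝔸_{F₀})` (weak approximation of the rational curve `x² − d y² = 1` at the finite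
set `S ∪ ∞`).

USE (Hodge-CM programme, crux H413, R90-TF S5∕S7∕S9): family-pin (J-a″) and the cofinite form of U♭ — «a discrete `P` routed by `ξ` off a finite set
and lying in the ξ′-envelope has `ξ = ξ′`» — via ★ `F0P3XiLocalLabelsOfMemXiFamily` (split labels) and this file (global half, split places off a finite set).

## References
* J. W. S. Cassels, A. Fröhlich (eds.), *Algebraic Number Theory* (1967): Ch. II (Cassels) §6 (weak approximation), Ch. VII (Tate) §4 Prop. 4.1
  and its proof [CasselsFrohlichANT1967].
* V. Platonov, A. Rapinchuk, *Algebraic Groups and Number Theory* (1994), §7.3 Prop. 7.8 (weak approximation for rational varieties) [PlatonovRapinchuk1994].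
* J. Rogawski, *Automorphic Representations of Unitary Groups in Three Variables* (1990), §13.1 p. 199, §13.3 p. 202 [Rogawski1990].
-/

set_option autoImplicit false

noncomputable section

open NumberField IsDedekindDomain
open Literature.NumberTheory.GaloisRepresentations
open Literature.NumberTheory.Automorphic.Arthur2013.Leaves.TECR
open scoped Topology

namespace Literature.NumberTheory.Automorphic

namespace UnitaryGroup

variable {F₀ K : Type} [Field F₀] [NumberField F₀] [Field K] [NumberField K] [Algebra F₀ K]
  (c : K ≃ₐ[F₀] K) (h2 : Module.finrank F₀ K = 2) (hc : c ≠ 1)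

/-! ## §0 The local estimate at a MOVED place: `c_*(b′) b⁻¹` for `b′` at `c⁻¹ • w` and `b` at `w`, both next to `1` -/

omit [NumberField F₀] in
/-- **Two-place twin of ★ `valued_gal_mul_inv_sub_one_le`**: for a `c`-moved pair `u ↦ w = c • u`, if `|b − 1|_w < q^{-(m+1)}` and `|b′ − 1|_u < q^{-(m+1)}`
then `|c_*(b′) · b⁻¹ − 1|_w ≤ q^{-m}` (`c_* : K_u → K_w` is an isometry with `c_*(1) = 1`). [cite: CasselsFrohlichANT1967, Ch. VII §1.1] -/
theorem valued_gal_mul_inv_sub_one_le_of_moved {u w : HeightOneSpectrum (𝓞 K)} (huw : c • u = w) (b : w.adicCompletion K)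
    (b' : u.adicCompletion K) (m : ℕ) (hb : Valued.v (b - 1) < WithZero.exp (-((m + 1 : ℕ) : ℤ)))
    (hb' : Valued.v (b' - 1) < WithZero.exp (-((m + 1 : ℕ) : ℤ))) :
    Valued.v (galAdicCompletionMap c huw b' * b⁻¹ - 1) ≤ WithZero.exp (-(m : ℤ)) := by
  have hle1 : WithZero.exp (-((m + 1 : ℕ) : ℤ)) ≤ (1 : WithZero (Multiplicative ℤ)) := by
    rw [← WithZero.exp_zero]
    exact WithZero.exp_le_exp.2 (by push_cast; omega)
  have hb1 : Valued.v (b - 1) < Valued.v (1 : w.adicCompletion K) := by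
    rw [map_one]; exact hb.trans_le hle1
  have hvb : Valued.v b = 1 := by rw [Valuation.map_eq_of_sub_lt _ hb1, map_one]
  have hb0 : b ≠ 0 := fun h => by rw [h, map_zero] at hvb; exact zero_ne_one hvb
  have hσ : Valued.v (galAdicCompletionMap c huw b' - 1) = Valued.v (b' - 1) := by
    rw [show galAdicCompletionMap c huw b' - 1 = galAdicCompletionMap c huw (b' - 1) by rw [map_sub, map_one],
      valued_galAdicCompletionMap]
  have hdiff : Valued.v (galAdicCompletionMap c huw b' - b) ≤ max (Valued.v (b' - 1)) (Valued.v (b - 1)) := by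
    have h := Valuation.map_sub (Valued.v : Valuation (w.adicCompletion K) _) (galAdicCompletionMap c huw b' - 1) (b - 1)
    rw [sub_sub_sub_cancel_right, hσ] at h
    exact h
  calc Valued.v (galAdicCompletionMap c huw b' * b⁻¹ - 1)
      = Valued.v ((galAdicCompletionMap c huw b' - b) * b⁻¹) := by rw [sub_mul, mul_inv_cancel₀ hb0]
    _ = Valued.v (galAdicCompletionMap c huw b' - b) := by rw [map_mul, map_inv₀, hvb, inv_one, mul_one]
    _ ≤ max (Valued.v (b' - 1)) (Valued.v (b - 1)) := hdiff
    _ ≤ WithZero.exp (-(m : ℤ)) :=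
        max_le (hb'.le.trans (WithZero.exp_le_exp.2 (by push_cast; omega))) (hb.le.trans (WithZero.exp_le_exp.2 (by push_cast; omega)))

/-! ## §1 An automorphic character of `T(𝔸_{F₀})` trivial at the split places OFF A FINITE SET is trivial -/

/-- **An automorphic character of `T(𝔸_{F₀})` whose base change is trivial on `K_wˣ` for every `c`-MOVED finite place `w` of `K` OUTSIDE A FINITE
SET `E` is trivial.**  The ★ proof of `torusCharacter_eq_one_of_split` with the `c`-stable exceptional set `E′ = E ∪ c • E` added to the
weak-approximation set (module docstring). [cite: CasselsFrohlichANT1967, Ch. VII §4 Prop. 4.1 (proof); Ch. II §6] [cite: PlatonovRapinchuk1994, §7.3 Prop. 7.8] -/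
theorem torusCharacter_eq_one_of_split_of_not_mem (E : Finset (HeightOneSpectrum (𝓞 K)))
    (ψ : ↥(TorusDict.torus c) →ₜ* ℂˣ) (hψ : TorusDict.IsAutomorphic c ψ)
    (h : ∀ w : HeightOneSpectrum (𝓞 K), c • w ≠ w → w ∉ E →
      ∀ a : (w.adicCompletion K)ˣ, TorusDict.pullback c h2 hc ψ hψ (localUnits w a) = 1) :
    ψ = 1 := by
  classical
  -- it suffices to kill the base change `χ = ψ ∘ twist` on all of `𝕀_K` (the twist is onto, idelic Hilbert 90)
  suffices hz : ∀ z : ideleGroup K, TorusDict.pullback c h2 hc ψ hψ z = 1 by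
    refine ContinuousMonoidHom.ext fun t => ?_
    obtain ⟨z, rfl⟩ := TorusDict.twistToTorus_surjective c h2 hc t
    rw [← TorusDict.pullback_apply c h2 hc ψ hψ, hz z]
    rfl
  intro z
  set χ : HeckeCharacter K := TorusDict.pullback c h2 hc ψ hψ with hχdef
  suffices hmain : ∀ W ∈ 𝓝 (1 : ℂˣ), χ z ∈ W by
    by_contra hx
    exact hmain {w | w ≠ χ z} (isOpen_ne.mem_nhds (Ne.symm hx)) rfl
  intro W hW
  -- a neighbourhood of `1` in the torus on which `ψ ∈ W`, lifted to `𝕀_K`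
  have hN : ψ ⁻¹' W ∈ 𝓝 (1 : ↥(TorusDict.torus c)) :=
    (map_continuous ψ).continuousAt.preimage_mem_nhds (by rwa [map_one])
  obtain ⟨H, hH, hHN⟩ := (mem_nhds_subtype _ (1 : ↥(TorusDict.torus c)) _).1 hN
  have hH1 : H ∈ 𝓝 (1 : ideleGroup K) := by simpa only [OneMemClass.coe_one] using hH
  obtain ⟨U₁, hU₁, T, hT, e, hTe⟩ := ideleGroup_exists_nhds_congruenceSubgroup_subset hH1
  have hkey : ∀ y : ideleGroup K, Herbrand.twist c y ∈ H → χ y ∈ W := fun y hy =>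
    hHN (show TorusDict.twistToTorus c h2 hc y ∈ Subtype.val ⁻¹' H from hy)
  set xinf : InfiniteAdeleRing K := (z : AdeleRing (𝓞 K) K).1 with hxinf
  set xiinf : InfiniteAdeleRing K := ((z⁻¹ : ideleGroup K) : AdeleRing (𝓞 K) K).1 with hxiinf
  have hinv : ∀ (y : ideleGroup K) (w : InfinitePlace K),
      ((y⁻¹ : ideleGroup K) : AdeleRing (𝓞 K) K).1 w = ((y : AdeleRing (𝓞 K) K).1 w)⁻¹ := by
    intro y w
    have hm := congrFun (ideleGroup_val_inv_fst_mul y) w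
    change ((y⁻¹ : ideleGroup K) : AdeleRing (𝓞 K) K).1 w * (y : AdeleRing (𝓞 K) K).1 w = 1 at hm
    exact eq_inv_of_mul_eq_one_left hm
  have hx0 : ∀ w : InfinitePlace K, xinf w ≠ 0 := by
    intro w
    have hm := congrFun (ideleGroup_val_inv_fst_mul z) w
    change xiinf w * xinf w = 1 at hm
    exact right_ne_zero_of_mul_eq_one hm
  have hxi : ∀ w : InfinitePlace K, xiinf w = (xinf w)⁻¹ := fun w => hinv z w
  have hxf0 : ∀ v : HeightOneSpectrum (𝓞 K), (z : AdeleRing (𝓞 K) K).2 v ≠ 0 := ideleGroup_snd_ne_zero z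
  -- the `c`-stable finite EXCEPTIONAL set `E' = E ∪ c • E` joins the weak-approximation set (the one change w.r.t. ★ `torusCharacter_eq_one_of_split`)
  set E' : Finset (HeightOneSpectrum (𝓞 K)) := E ∪ E.image (fun w => c • w) with hE'def
  have hE'E : ∀ w, w ∉ E' → w ∉ E := fun w hw hwE => hw (Finset.mem_union_left _ hwE)
  have hE'smul : ∀ w, w ∈ E' → c • w ∈ E' := by
    intro w hw
    rcases Finset.mem_union.1 hw with hwE | hwE
    · exact Finset.mem_union_right _ (Finset.mem_image_of_mem _ hwE)
    · obtain ⟨w', hw', rfl⟩ := Finset.mem_image.1 hwE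
      rw [smul_smul_place c h2 hc]
      exact Finset.mem_union_left _ hw'
  have hE'inv : ∀ w, w ∈ E' → c⁻¹ • w ∈ E' := fun w hw => by rw [inv_smul_place c h2 hc]; exact hE'smul w hw
  have hE'of_smul : ∀ w, c • w ∈ E' → w ∈ E' := fun w hw => by
    have h' := hE'smul _ hw
    rwa [smul_smul_place c h2 hc] at h'
  have hE'of_inv : ∀ w, c⁻¹ • w ∈ E' → w ∈ E' := fun w hw => by
    have h' := hE'smul _ hw
    rwa [smul_inv_smul] at h'
  set S : Finset (HeightOneSpectrum (𝓞 K)) := hT.toFinset ∪ E' with hSdef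
  -- the space `Y = (∏_{v ∈ S} K_v) × K_∞`, the target point and the test maps
  let y₀ : (∀ v : S, v.1.adicCompletion K) × InfiniteAdeleRing K := (fun v => (z : AdeleRing (𝓞 K) K).2 v.1, xinf)
  let f₁ : (∀ v : S, v.1.adicCompletion K) × InfiniteAdeleRing K → InfiniteAdeleRing K :=
    fun p => fun w => xinf w * (p.2 w)⁻¹
  let f₂ : (∀ v : S, v.1.adicCompletion K) × InfiniteAdeleRing K → InfiniteAdeleRing K :=
    fun p => fun w => p.2 w * xiinf w
  let F₁ : (∀ v : S, v.1.adicCompletion K) × InfiniteAdeleRing K → InfiniteAdeleRing K :=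
    fun p => c • f₁ p * f₂ p
  let F₂ : (∀ v : S, v.1.adicCompletion K) × InfiniteAdeleRing K → InfiniteAdeleRing K :=
    fun p => f₁ p * c • f₂ p
  let g : ∀ v : S, (∀ v : S, v.1.adicCompletion K) × InfiniteAdeleRing K → v.1.adicCompletion K :=
    fun v p => (z : AdeleRing (𝓞 K) K).2 v.1 * (p.1 v)⁻¹
  have hf₁ : ContinuousAt f₁ y₀ := by
    refine continuousAt_pi.2 fun w => ?_
    have hcw : ContinuousAt (fun p : (∀ v : S, v.1.adicCompletion K) × InfiniteAdeleRing K => p.2 w) y₀ :=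
      ((continuous_apply w).comp continuous_snd).continuousAt
    exact continuousAt_const.mul (hcw.inv₀ (hx0 w))
  have hf₂ : ContinuousAt f₂ y₀ := by
    refine continuousAt_pi.2 fun w => ?_
    have hcw : ContinuousAt (fun p : (∀ v : S, v.1.adicCompletion K) × InfiniteAdeleRing K => p.2 w) y₀ :=
      ((continuous_apply w).comp continuous_snd).continuousAt
    exact hcw.mul continuousAt_const
  have hF₁ : ContinuousAt F₁ y₀ := ((continuous_const_smul c).continuousAt.comp hf₁).mul hf₂
  have hF₂ : ContinuousAt F₂ y₀ := hf₁.mul ((continuous_const_smul c).continuousAt.comp hf₂)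
  have hg : ∀ v, ContinuousAt (g v) y₀ := by
    intro v
    have hcv : ContinuousAt (fun p : (∀ v : S, v.1.adicCompletion K) × InfiniteAdeleRing K => p.1 v) y₀ :=
      ((continuous_apply v).comp continuous_fst).continuousAt
    exact continuousAt_const.mul (hcv.inv₀ (hxf0 v.1))
  have hf₁y : f₁ y₀ = 1 := funext fun w => mul_inv_cancel₀ (hx0 w)
  have hf₂y : f₂ y₀ = 1 := funext fun w => by
    change xinf w * xiinf w = 1
    rw [hxi, mul_inv_cancel₀ (hx0 w)]
  have hF₁y : F₁ y₀ = 1 := by change c • f₁ y₀ * f₂ y₀ = 1; rw [hf₁y, hf₂y, smul_one, mul_one]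
  have hF₂y : F₂ y₀ = 1 := by change f₁ y₀ * c • f₂ y₀ = 1; rw [hf₁y, hf₂y, smul_one, mul_one]
  have hgy : ∀ v, g v y₀ = 1 := fun v => mul_inv_cancel₀ (hxf0 v.1)
  -- congruence balls are neighbourhoods of `1`
  have hB : ∀ (v : HeightOneSpectrum (𝓞 K)) (m : ℕ),
      {b : v.adicCompletion K | Valued.v (b - 1) < WithZero.exp (-(m : ℤ))} ∈ 𝓝 (1 : v.adicCompletion K) := by
    intro v m
    set π : v.adicCompletion K := ((HeckeCharacter.uniformizer K v : (v.adicCompletion K)ˣ) : v.adicCompletion K) ^ m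
      with hπdef
    have hπ : Valued.v π = WithZero.exp (-(m : ℤ)) := by
      rw [hπdef, map_pow, HeckeCharacter.valued_uniformizer, ← WithZero.exp_nsmul]
      congr 1
      simp
    have hopen : IsOpen {b : v.adicCompletion K | Valued.v (b - 1) < Valued.v π} := by
      have h1 : IsOpen {y : v.adicCompletion K | Valued.v y < Valued.v π} := by
        simpa only [Valuation.restrict_lt_iff] using Valued.isOpen_ball (v.adicCompletion K) (Valued.v.restrict π)
      exact h1.preimage (continuous_id.sub continuous_const)
    rw [← hπ]
    refine hopen.mem_nhds ?_
    change Valued.v ((1 : v.adicCompletion K) - 1) < Valued.v π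
    rw [sub_self, map_zero, hπ]
    exact zero_lt_iff.2 WithZero.coe_ne_zero
  obtain ⟨w₀⟩ : Nonempty (InfinitePlace K) := inferInstance
  have hO : {p : (∀ v : S, v.1.adicCompletion K) × InfiniteAdeleRing K | p.2 w₀ ≠ 0} ∈ 𝓝 y₀ :=
    (isOpen_ne_fun ((continuous_apply w₀).comp continuous_snd) continuous_const).mem_nhds (hx0 w₀)
  -- the good neighbourhood of `y₀` and an `a ∈ K` in it
  have h𝒩 : F₁ ⁻¹' U₁ ∩ (F₂ ⁻¹' U₁ ∩ ({p | p.2 w₀ ≠ 0} ∩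
      ⋂ v : S, g v ⁻¹' {b | Valued.v (b - 1) < WithZero.exp (-((e v.1 + e (c • v.1) + 1 : ℕ) : ℤ))})) ∈ 𝓝 y₀ := by
    refine Filter.inter_mem (hF₁.preimage_mem_nhds (by rw [hF₁y]; exact hU₁))
      (Filter.inter_mem (hF₂.preimage_mem_nhds (by rw [hF₂y]; exact hU₁))
        (Filter.inter_mem hO ((Filter.iInter_mem).2 fun v => ?_)))
    exact (hg v).preimage_mem_nhds (by rw [hgy]; exact hB v.1 _)
  obtain ⟨a, ha₁, ha₂, ha₃, ha₄⟩ := (denseRange_algebraMap_pi_prod S).mem_nhds h𝒩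
  simp only [Set.mem_iInter, Set.mem_preimage, Set.mem_setOf_eq] at ha₁ ha₂ ha₃ ha₄
  have ha0 : a ≠ 0 := by
    rintro rfl
    exact ha₃ (by rw [map_zero]; rfl)
  -- `y = z · (a)⁻¹`, its components
  set A : Kˣ := Units.mk0 a ha0 with hA
  have haA : ((A : Kˣ) : K) = a := rfl
  set y : ideleGroup K := z * (GaloisRepresentations.principalIdele K A)⁻¹ with hy
  have hy1 : ∀ w, (y : AdeleRing (𝓞 K) K).1 w = xinf w * (algebraMap K (InfiniteAdeleRing K) a w)⁻¹ := fun w => by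
    rw [hy, ideleGroup_val_fst_mul]
    change xinf w * ((((GaloisRepresentations.principalIdele K A)⁻¹ : ideleGroup K) : AdeleRing (𝓞 K) K).1 w) = _
    rw [hinv, GaloisRepresentations.principalIdele_fst, haA]
  have hy1' : (y : AdeleRing (𝓞 K) K).1 =
      f₁ ((fun v : S => algebraMap K (v.1.adicCompletion K) a), algebraMap K (InfiniteAdeleRing K) a) :=
    funext fun w => hy1 w
  have hyi1 : ∀ w, ((y⁻¹ : ideleGroup K) : AdeleRing (𝓞 K) K).1 w = algebraMap K (InfiniteAdeleRing K) a w * xiinf w :=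
    fun w => by rw [hinv, hy1, mul_inv_rev, inv_inv, hxi]
  have hy2 : ∀ v, (y : AdeleRing (𝓞 K) K).2 v = (z : AdeleRing (𝓞 K) K).2 v * (algebraMap K (v.adicCompletion K) a)⁻¹ :=
    fun v => by
    rw [hy, ideleGroup_val_snd_mul, ideleGroup_val_inv_snd, GaloisRepresentations.principalIdele_snd, haA]
  have hy20 : ∀ v, (y : AdeleRing (𝓞 K) K).2 v ≠ 0 := ideleGroup_snd_ne_zero y
  -- the finitely many `c`-MOVED places to peel off (named by the neighbourhood, or where `y` is not a unit), `c`-stable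
  have hT₀ := ideleGroup_valued_snd_eventually_eq_one y
  rw [Filter.eventually_cofinite] at hT₀
  set B : Finset (HeightOneSpectrum (𝓞 K)) := hT₀.toFinset ∪ S with hBdef
  -- peel only the MOVED places OUTSIDE the exceptional set `E'` (there the hypothesis `h` is available)
  set Q : Finset (HeightOneSpectrum (𝓞 K)) := (B ∪ B.image (fun w => c • w)).filter (fun w => c • w ≠ w ∧ w ∉ E') with hQdef
  have hQmoved : ∀ w ∈ Q, c • w ≠ w := fun w hw => (Finset.mem_filter.1 hw).2.1
  have hQE' : ∀ w ∈ Q, w ∉ E' := fun w hw => (Finset.mem_filter.1 hw).2.2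
  have hQsmul : ∀ w ∈ Q, c • w ∈ Q := by
    intro w hw
    obtain ⟨hwB, hwm, hwE⟩ := Finset.mem_filter.1 hw
    refine Finset.mem_filter.2 ⟨?_, ?_, fun h' => hwE (hE'of_smul w h')⟩
    · rcases Finset.mem_union.1 hwB with hB | hB
      · exact Finset.mem_union_right _ (Finset.mem_image_of_mem _ hB)
      · obtain ⟨w', hw', rfl⟩ := Finset.mem_image.1 hB
        rw [smul_smul_place c h2 hc]
        exact Finset.mem_union_left _ hw'
    · rw [smul_smul_place c h2 hc]
      exact fun h' => hwm h'.symm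
  have hQinv : ∀ w ∈ Q, c⁻¹ • w ∈ Q := fun w hw => by rw [inv_smul_place c h2 hc]; exact hQsmul w hw
  have hBQ : ∀ w ∈ B, c • w ≠ w → w ∉ E' → w ∈ Q := fun w hwB hwm hwE =>
    Finset.mem_filter.2 ⟨Finset.mem_union_left _ hwB, hwm, hwE⟩
  have hBQ' : ∀ w, c • w ∈ B → c • w ≠ w → w ∉ E' → w ∈ Q := fun w hwB hwm hwE => by
    refine Finset.mem_filter.2 ⟨Finset.mem_union_right _ ?_, hwm, hwE⟩
    refine Finset.mem_image.2 ⟨c • w, hwB, smul_smul_place c h2 hc w⟩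
  -- at the exceptional places the weak approximation already put `y` next to `1`
  have hE'S : ∀ w, w ∈ E' → w ∈ S := fun w hw => Finset.mem_union_right _ hw
  have hnear : ∀ (w : HeightOneSpectrum (𝓞 K)) (hw : w ∈ S),
      Valued.v ((y : AdeleRing (𝓞 K) K).2 w - 1) < WithZero.exp (-((e w + e (c • w) + 1 : ℕ) : ℤ)) := fun w hw => by
    have hlt := ha₄ ⟨w, hw⟩
    change Valued.v ((z : AdeleRing (𝓞 K) K).2 w * (algebraMap K (w.adicCompletion K) a)⁻¹ - 1) < _ at hlt
    rw [hy2]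
    exact hlt
  have hunit_of_near : ∀ (w : HeightOneSpectrum (𝓞 K)), w ∈ S → Valued.v ((y : AdeleRing (𝓞 K) K).2 w) = 1 := fun w hw => by
    have h1 : Valued.v ((y : AdeleRing (𝓞 K) K).2 w - 1) < Valued.v (1 : w.adicCompletion K) := by
      rw [map_one, ← WithZero.exp_zero]
      exact (hnear w hw).trans_le (WithZero.exp_le_exp.2 (by push_cast; omega))
    rw [Valuation.map_eq_of_sub_lt _ h1, map_one]
  have hunitB : ∀ w, w ∉ B → Valued.v ((y : AdeleRing (𝓞 K) K).2 w) = 1 := fun w hw => by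
    by_contra hne
    exact hw (Finset.mem_union_left _ (hT₀.mem_toFinset.2 hne))
  -- the peeled idele `y₁` and the peel `y₂`
  let Yu : ∀ w : HeightOneSpectrum (𝓞 K), (w.adicCompletion K)ˣ := fun w => Units.mk0 ((y : AdeleRing (𝓞 K) K).2 w) (hy20 w)
  set y₂ : ideleGroup K := ∏ w ∈ Q, localUnits w (Yu w) with hy₂
  set y₁ : ideleGroup K := y * ∏ w ∈ Q, localUnits w (Yu w)⁻¹ with hy₁
  have hyy : y = y₁ * y₂ := by
    rw [hy₁, hy₂, mul_assoc, ← Finset.prod_mul_distrib]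
    rw [Finset.prod_eq_one fun w _ => by rw [← map_mul, inv_mul_cancel, map_one], mul_one]
  have hχy₂ : χ y₂ = 1 := by
    rw [hy₂, map_prod]
    exact Finset.prod_eq_one fun w hw => h w (hQmoved w hw) (hE'E w (hQE' w hw)) (Yu w)
  have hy₁1 : (y₁ : AdeleRing (𝓞 K) K).1 = (y : AdeleRing (𝓞 K) K).1 := by
    rw [hy₁, ideleGroup_val_fst_mul, fst_prod_localUnits, mul_one]
  have hy₁i1 : ((y₁⁻¹ : ideleGroup K) : AdeleRing (𝓞 K) K).1 = ((y⁻¹ : ideleGroup K) : AdeleRing (𝓞 K) K).1 := by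
    funext w
    rw [hinv, hinv, hy₁1]
  have hy₁2 : ∀ w, (y₁ : AdeleRing (𝓞 K) K).2 w = if w ∈ Q then 1 else (y : AdeleRing (𝓞 K) K).2 w := fun w => by
    rw [hy₁, ideleGroup_val_snd_mul, snd_prod_localUnits]
    split_ifs with hw
    · rw [Units.val_inv_eq_inv_val, Units.val_mk0, mul_inv_cancel₀ (hy20 w)]
    · rw [mul_one]
  have hyi1' : ((y⁻¹ : ideleGroup K) : AdeleRing (𝓞 K) K).1 =
      f₂ ((fun v : S => algebraMap K (v.1.adicCompletion K) a), algebraMap K (InfiniteAdeleRing K) a) :=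
    funext fun w => hyi1 w
  -- `twist y₁` lies in the prescribed neighbourhood of `1`
  have htw : Herbrand.twist c y₁ ∈ H := by
    refine hTe (Herbrand.twist c y₁) ?_ ?_ (fun w => ?_) (fun w hw => ?_)
    · -- archimedean part
      rw [twist_fst, hy₁1, hy₁i1, hy1', hyi1']
      exact ha₁
    · -- archimedean part of the inverse
      rw [twist_inv_fst, hy₁1, hy₁i1, hy1', hyi1']
      exact ha₂
    · -- every finite component of `twist y₁` is a unit
      by_cases hwc : c • w = w
      · exact TorusDict.valuation_eq_one_of_mem_torus c (TorusDict.twist_mem_torus c h2 hc y₁) hwc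
      · rw [twist_snd_apply, map_mul, map_inv₀, valued_galAdicCompletionMap, hy₁2, hy₁2]
        by_cases hwQ : w ∈ Q
        · rw [if_pos (hQinv w hwQ), if_pos hwQ, map_one, map_one, inv_one, mul_one]
        · have hwQ' : c⁻¹ • w ∉ Q := fun h' => hwQ (by
            have := hQsmul _ h'
            rwa [smul_inv_smul] at this)
          rw [if_neg hwQ', if_neg hwQ]
          by_cases hwE : w ∈ E'
          · -- exceptional moved place: `y` is next to `1` at `w` and at `c⁻¹ • w` (both lie in `S`)
            rw [hunit_of_near _ (hE'S _ (hE'inv w hwE)), hunit_of_near _ (hE'S _ hwE), inv_one, mul_one]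
          · have hwB : w ∉ B := fun h' => hwQ (hBQ w h' hwc hwE)
            have hwB' : c⁻¹ • w ∉ B := fun h' => hwQ (hBQ' w (by rwa [inv_smul_place c h2 hc] at h') hwc hwE)
            rw [hunitB _ hwB', hunitB _ hwB, inv_one, mul_one]
    · -- the congruences at the places named by the neighbourhood
      have hwS : w ∈ S := Finset.mem_union_left _ (hT.mem_toFinset.2 hw)
      have hwB : w ∈ B := Finset.mem_union_right _ hwS
      by_cases hwc : c • w = w
      · have hwQ : w ∉ Q := fun h' => hQmoved w h' hwc
        rw [twist_snd_apply_of_smul_eq c y₁ hwc, hy₁2, if_neg hwQ]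
        exact valued_gal_mul_inv_sub_one_le c hwc _ (e w)
          ((hnear w hwS).trans_le (WithZero.exp_le_exp.2 (by push_cast; omega)))
      · by_cases hwE : w ∈ E'
        · -- exceptional moved place named by the neighbourhood: both `y_w` and `y_{c⁻¹ w}` are next to `1`
          have hwQ : w ∉ Q := fun h' => hQE' w h' hwE
          have hwQ' : c⁻¹ • w ∉ Q := fun h' => hQE' _ h' (hE'inv w hwE)
          rw [twist_snd_apply, hy₁2, hy₁2, if_neg hwQ', if_neg hwQ]
          refine valued_gal_mul_inv_sub_one_le_of_moved c (smul_inv_smul c w) _ _ (e w)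
            ((hnear w hwS).trans_le (WithZero.exp_le_exp.2 (by push_cast; omega))) ?_
          have h' := hnear (c⁻¹ • w) (hE'S _ (hE'inv w hwE))
          rw [smul_inv_smul] at h'
          exact h'.trans_le (WithZero.exp_le_exp.2 (by push_cast; omega))
        · have hwQ : w ∈ Q := hBQ w hwB hwc hwE
          rw [twist_snd_apply, hy₁2, hy₁2, if_pos (hQinv w hwQ), if_pos hwQ, map_one, inv_one, mul_one, sub_self,
            map_zero]
          exact zero_le
  -- assemble: `χ z = χ (a) · χ y₁ · χ y₂ = χ y₁ ∈ W`
  have hz' : z = GaloisRepresentations.principalIdele K A * (y₁ * y₂) := by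
    rw [← hyy, hy, mul_comm (GaloisRepresentations.principalIdele K A) (z * (GaloisRepresentations.principalIdele K A)⁻¹),
      inv_mul_cancel_right]
  rw [hz', map_mul, map_mul, χ.map_principal (GaloisRepresentations.principalIdele_mem A), one_mul, hχy₂, mul_one]
  exact hkey y₁ htw


/-! ## §2 Two automorphic characters with the same local components at the split places off a finite set are equal -/

/-- **RIGIDITY FROM THE SPLIT PLACES OFF A FINITE SET (base-change currency).**  Two automorphic characters `ψ, ψ′` of `T(𝔸_{F₀})` whose base changes
have the same local component `χ̃_w = χ̃′_w` (★ `HeckeCharacter.localComponent`) at every `c`-moved finite place `w ∉ E` (`E` finite) are equal.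
[cite: CasselsFrohlichANT1967, Ch. VII §4 Prop. 4.1 (proof); Ch. II §6] [cite: PlatonovRapinchuk1994, §7.3 Prop. 7.8] -/
theorem torusCharacter_eq_of_split_of_not_mem (E : Finset (HeightOneSpectrum (𝓞 K))) (ψ ψ' : ↥(TorusDict.torus c) →ₜ* ℂˣ)
    (hψ : TorusDict.IsAutomorphic c ψ) (hψ' : TorusDict.IsAutomorphic c ψ')
    (h : ∀ w : HeightOneSpectrum (𝓞 K), c • w ≠ w → w ∉ E →
      (TorusDict.pullback c h2 hc ψ hψ).localComponent w = (TorusDict.pullback c h2 hc ψ' hψ').localComponent w) :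
    ψ = ψ' := by
  have h1 : ψ * ψ'⁻¹ = 1 := by
    refine torusCharacter_eq_one_of_split_of_not_mem c h2 hc E (ψ * ψ'⁻¹) (isAutomorphic_mul_inv c hψ hψ') fun w hw hwE a => ?_
    rw [pullback_mul_inv_apply c h2 hc hψ hψ', ← HeckeCharacter.localComponent_apply, ← HeckeCharacter.localComponent_apply, h w hw hwE,
      mul_inv_cancel]
  exact mul_inv_eq_one.1 h1

/-- **One place of each pair `{w, c • w}` suffices** (off the finite set): if at every moved `w ∉ E` the base changes agree at `w` OR at `c • w`, then `ψ = ψ′`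
(the component at `c • w` determines the one at `w`: ★ `pullback_localComponent_smul`, the split-place convention `χ̃_{c•w} ∘ c_w = χ̃_w⁻¹`).
[cite: Rogawski1990, §12.2 pp. 173–174] [cite: CasselsFrohlichANT1967, Ch. VII §4 Prop. 4.1 (proof)] -/
theorem torusCharacter_eq_of_split_of_not_mem' (E : Finset (HeightOneSpectrum (𝓞 K))) (ψ ψ' : ↥(TorusDict.torus c) →ₜ* ℂˣ)
    (hψ : TorusDict.IsAutomorphic c ψ) (hψ' : TorusDict.IsAutomorphic c ψ')
    (h : ∀ w : HeightOneSpectrum (𝓞 K), c • w ≠ w → w ∉ E →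
      (TorusDict.pullback c h2 hc ψ hψ).localComponent w = (TorusDict.pullback c h2 hc ψ' hψ').localComponent w ∨
        (TorusDict.pullback c h2 hc ψ hψ).localComponent (c • w) =
          (TorusDict.pullback c h2 hc ψ' hψ').localComponent (c • w)) :
    ψ = ψ' := by
  refine torusCharacter_eq_of_split_of_not_mem c h2 hc E ψ ψ' hψ hψ' fun w hw hwE => ?_
  rcases h w hw hwE with hwe | hcw
  · exact hwe
  · refine MonoidHom.ext fun a => ?_
    have key := DFunLike.congr_fun hcw (galAdicCompletionUnitsEquiv (L := K) c rfl a)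
    rw [pullback_localComponent_smul K c h2 hc ψ hψ w a, pullback_localComponent_smul K c h2 hc ψ' hψ' w a] at key
    exact inv_injective key

/-- **Torus-local currency** (★ `torusLocalComponent`'s frame = places `v` of `F₀`): two automorphic characters `ψ, ψ′` whose base changes agree at ONE moved
place `w` above every split `v` of `F₀` outside a finite set `S₁` are equal — the single place suffices because the exceptional set `{w, c • w : w over S₁}`
is finite and at a moved `w′` over `v ∉ S₁` either `w′` or `c • w′` is the given witness (the base changes of `ψ, ψ′` at `c • w` are determined by those at
`w`: ★ `torusCharacter_eq_of_split'`'s pairing argument is NOT needed here — we ask the witness at EVERY moved place outside the exceptional set, which the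
consumers have). [cite: CasselsFrohlichANT1967, Ch. VII §4 Prop. 4.1 (proof)] -/
theorem torusCharacter_eq_of_split_of_forall_not_mem_under (S₁ : Finset (HeightOneSpectrum (𝓞 F₀))) (ψ ψ' : ↥(TorusDict.torus c) →ₜ* ℂˣ)
    (hψ : TorusDict.IsAutomorphic c ψ) (hψ' : TorusDict.IsAutomorphic c ψ')
    (h : ∀ w : HeightOneSpectrum (𝓞 K), c • w ≠ w → w.under (𝓞 F₀) ∉ S₁ →
      (TorusDict.pullback c h2 hc ψ hψ).localComponent w = (TorusDict.pullback c h2 hc ψ' hψ').localComponent w) :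
    ψ = ψ' := by
  classical
  refine torusCharacter_eq_of_split_of_not_mem c h2 hc
    (S₁.biUnion fun v => (Finset.univ : Finset (PlacesOver K v)).image fun w => w.1) ψ ψ' hψ hψ' fun w hw hwE => h w hw fun hv => ?_
  exact hwE (Finset.mem_biUnion.2 ⟨w.under (𝓞 F₀), hv, Finset.mem_image.2 ⟨⟨w, rfl⟩, Finset.mem_univ _, rfl⟩⟩)

end UnitaryGroup

end Literature.NumberTheory.Automorphic

end
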